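/-
Copyright (c) 2026. All rights reserved.
Released under Apache 2.0 license as described in the file LICENSE.
-/
import Summits.HodgeConjecture.HodgeConjecture.Theorems.K2LiuArchStabIwasawaOfFrame        -- ★ FILE 16 `exists_siegel_mul_stab_archLocal`
import Summits.HodgeConjecture.HodgeConjecture.Theorems.K2LiuArchCompactPictureInjective    -- ★ `eq_of_isArchSiegelDeltaSection_of_eq_on_prodK`
import HarnessLib

/-!
# Crux `HLiu418`, F4 B3-b §2 (congr) TRANSPORT, ARCH-SECTION HALF — the FRAME COMPACT `K_fr = ∏_w {k_w : T_w k_w T_w⁻¹ ∈ Stab(i·1)}` has the per-place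
# Iwasawa decomposition (★ 2c-inst's letter `hk2`), hence two arch Siegel sections of the same law which agree on `K_fr` are EQUAL

Cell `hodgecm-mathlib`, crux item hLiu418 = `stmt-HodgeConjecture-24832` (helper lane `--supports`, count-neutral).  K2Liu-p11 (g4); BATCH #133 (1) «§2 transport»
second pen (consumers: R90-C10-p03 (g0) B3-b `K2LiuArchSWDataInduction` (congr) step, K2Liu-p27 (g2) B3-a; also ★ FILE 18's internal `hk2`).
Frame letters of ★ `K2LiuHolTubeRigidityOfFrame` §2 ∕ ★ arch₃∕arch₄ BY VALUE (`T Tinv hT2 hTU hTV` + Shimura shape `hTsh hC`), general `n`.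
* §1 **`exists_siegel_mul_frameCompact`** — ★ 2c-inst's `hk2` AT THE FRAME COMPACT: every `g ∈ H_w` is `p·k` with the slice of `p` Siegel (`IsSiegelDelta`) and
  `T_w k T_w⁻¹ ∈ Stab(i1)` (★ FILE 16 `exists_siegel_mul_stab_archLocal` + ★ `isSiegelDelta_slice_of_toBlocks₂₁`).
* §2 **`eq_of_eq_on_frameCompact`** — (congr) TRANSPORT: `A, A′ ∈ I_∞(s, χ)` (★ `IsArchSiegelDeltaSection`) with `A = A′` on `archPiEquivCM⁻¹(K_fr)` ⇒ `A = A′`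
  (★ `eq_of_isArchSiegelDeltaSection_of_eq_on_prodK` at `Kw := K_fr`).  So a one-place replacement that does not change the values on `K_fr` does not change the
  section — the arch-section half of «same one-place section at σ ⇒ same `genFamily`».
References: [Knapp1986, Ch. VII §1]; [BorelJacquet1979, §4.1]; [Tan1999, §1]; [Shimura1997, §6.5].
HONEST LABEL: HC_CM is proved only modulo the 7 printed citations (2 remaining named inputs: hLiu418 = stmt-HodgeConjecture-24832,
h413 = stmt-HodgeConjecture-24833) until rung 0 closes; count-neutral helper, closes no socket.
-/

set_option autoImplicit false
set_option linter.dupNamespace false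

noncomputable section

open scoped Matrix ComplexConjugate Classical
open Complex Matrix NumberField NumberField.InfinitePlace
open Literature.NumberTheory.ModularForms.SiegelUpperHalfSpace (moeb)
open Literature.NumberTheory.Automorphic Literature.NumberTheory.Automorphic.UnitaryGroup Literature.NumberTheory.GaloisRepresentations
open Literature.NumberTheory.GelbartRogawski1991 Literature.NumberTheory.GelbartRogawski1991.GRConstruction
open Literature.NumberTheory.GelbartRogawski1991.UnitaryDualPair
open Literature.NumberTheory.K2Lit.SiegelDoubled

namespace Summit.HodgeConjecture.HodgeConjecture.Cruxes.HLiu418.K2LiuArchSectionEqOfFrameCompact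

open K2LiuArchInducedTubeDefs K2LiuSiegelUnipotentLocalDefs K2LiuArchSWSpanningDefs
open K2LiuArchSiegelCharacterTube (isSiegelDelta_slice_of_toBlocks₂₁)
open K2LiuArchStabIwasawaOfFrame (exists_siegel_mul_stab_archLocal)
open K2LiuArchCompactPictureInjective (eq_of_isArchSiegelDeltaSection_of_eq_on_prodK)

variable (L : Type) [Field L] [NumberField L] [IsCMField L] {N M n : ℕ} (e : Fin N × Fin M ≃ Fin n)
  (dV : Fin N → L) (hdV : ∀ i, IsCMField.complexConj L (dV i) = dV i)
  (dW : Fin M → L) (hdW : ∀ i, IsCMField.complexConj L (dW i) = dW i)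
  (T Tinv : {w : InfinitePlace L // w.IsComplex} → Matrix (Fin n ⊕ Fin n) (Fin n ⊕ Fin n) ℂ)
  (hT2 : ∀ w, Tinv w * T w = 1)
  (hTU : ∀ w (g : GL (Fin (n + n)) ℂ), g ∈ UnitaryGroup.archLocal L (n + n) (hermD L e dV hdV dW hdW) w →
    (T w * Matrix.reindex (e₂ (n := n)).symm (e₂ (n := n)).symm (g : Matrix _ _ ℂ) * Tinv w)ᴴ * Matrix.J (Fin n) ℂ *
      (T w * Matrix.reindex (e₂ (n := n)).symm (e₂ (n := n)).symm (g : Matrix _ _ ℂ) * Tinv w) = Matrix.J (Fin n) ℂ)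
  (hTV : ∀ w (P : Matrix (Fin n ⊕ Fin n) (Fin n ⊕ Fin n) ℂ), Pᴴ * Matrix.J (Fin n) ℂ * P = Matrix.J (Fin n) ℂ →
    ∃ g : GL (Fin (n + n)) ℂ, g ∈ UnitaryGroup.archLocal L (n + n) (hermD L e dV hdV dW hdW) w ∧
      T w * Matrix.reindex (e₂ (n := n)).symm (e₂ (n := n)).symm (g : Matrix _ _ ℂ) * Tinv w = P)
  (D C : {w : InfinitePlace L // w.IsComplex} → Matrix (Fin n) (Fin n) ℂ)
  (hTsh : ∀ w, T w = fromBlocks (D w) (D w) (C w) (-(C w))) (hC : ∀ w, IsUnit (C w).det)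

/-! ## §1  ★ 2c-inst's `hk2` at the frame compact -/

include hT2 hTU hTV hTsh hC in
/-- **THE PER-PLACE IWASAWA DECOMPOSITION AT THE FRAME COMPACT** (★ 2c-inst's letter `hk2` with `Kw w := {k | T_w k T_w⁻¹ ∈ Stab(i1)}`).
[Knapp1986, Ch. VII §1] [Shimura1997, §6.5] -/
theorem exists_siegel_mul_frameCompact (w : {w : InfinitePlace L // w.IsComplex}) (g : UnitaryGroup.archLocal L (n + n) (hermD L e dV hdV dW hdW) w) :
    ∃ p : UnitaryGroup.archLocal L (n + n) (hermD L e dV hdV dW hdW) w,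
      IsSiegelDelta L e dV hdV dW hdW (UnitaryGroup.archToAdelic (Fp L) L (IsCMField.complexConj L) (n + n) (hermD L e dV hdV dW hdW)
        ((UnitaryGroup.archPiEquivCM (n + n) L (hermD L e dV hdV dW hdW)).symm (Pi.mulSingle w p))) ∧
      ∃ k ∈ {k : UnitaryGroup.archLocal L (n + n) (hermD L e dV hdV dW hdW) w |
          moeb (T w * Matrix.reindex (e₂ (n := n)).symm (e₂ (n := n)).symm ((k : GL (Fin (n + n)) ℂ) : Matrix (Fin (n + n)) (Fin (n + n)) ℂ) * Tinv w)
            (I • (1 : Matrix (Fin n) (Fin n) ℂ)) = I • 1}, g = p * k := by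
  obtain ⟨p, k, hp, hk, hTp, hTk, hdec⟩ := exists_siegel_mul_stab_archLocal L e dV hdV dW hdW T Tinv hT2 hTU hTV w g.2
  have hinv : Tinv w * fromBlocks (D w) (D w) (C w) (-(C w)) = 1 := by rw [← hTsh]; exact hT2 w
  have hP : (fromBlocks (D w) (D w) (C w) (-(C w)) * Matrix.reindex (e₂ (n := n)).symm (e₂ (n := n)).symm (p : Matrix (Fin (n + n)) (Fin (n + n)) ℂ) *
      Tinv w).toBlocks₂₁ = 0 := by rw [← hTsh]; exact hTp
  exact ⟨⟨p, hp⟩, isSiegelDelta_slice_of_toBlocks₂₁ L e dV hdV dW hdW w (D w) (C w) (Tinv w) hinv (hC w) ⟨p, hp⟩ hP, ⟨k, hk⟩, hTk, Subtype.ext hdec⟩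

/-! ## §2  (congr) TRANSPORT: equality on the frame compact ⇒ equality -/

include hT2 hTU hTV hTsh hC in
/-- **(congr) TRANSPORT, ARCH-SECTION HALF**: two arch Siegel sections of the same law `I_∞(s, χ)` which agree at every place-tuple of the frame compact
`K_fr = ∏_w {k_w | T_w k_w T_w⁻¹ ∈ Stab(i·1)}` are equal. [Knapp1986, Ch. VII §1] [BorelJacquet1979, §4.1] [Tan1999, §1] -/
theorem eq_of_eq_on_frameCompact (χ : HeckeCharacter L) (s : ℂ) {A A' : UnitaryGroup.arch (Fp L) L (IsCMField.complexConj L) (n + n) (hermD L e dV hdV dW hdW) → ℂ}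
    (hA : IsArchSiegelDeltaSection L e dV hdV dW hdW χ s A) (hA' : IsArchSiegelDeltaSection L e dV hdV dW hdW χ s A')
    (hK : ∀ k : ∀ w : {w : InfinitePlace L // w.IsComplex}, UnitaryGroup.archLocal L (n + n) (hermD L e dV hdV dW hdW) w,
      (∀ w, moeb (T w * Matrix.reindex (e₂ (n := n)).symm (e₂ (n := n)).symm ((k w : GL (Fin (n + n)) ℂ) : Matrix (Fin (n + n)) (Fin (n + n)) ℂ) * Tinv w)
        (I • (1 : Matrix (Fin n) (Fin n) ℂ)) = I • 1) →
      A ((UnitaryGroup.archPiEquivCM (n + n) L (hermD L e dV hdV dW hdW)).symm k) =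
        A' ((UnitaryGroup.archPiEquivCM (n + n) L (hermD L e dV hdV dW hdW)).symm k)) :
    A = A' :=
  eq_of_isArchSiegelDeltaSection_of_eq_on_prodK L e dV hdV dW hdW χ s hA hA'
    (fun w => {k : UnitaryGroup.archLocal L (n + n) (hermD L e dV hdV dW hdW) w |
      moeb (T w * Matrix.reindex (e₂ (n := n)).symm (e₂ (n := n)).symm ((k : GL (Fin (n + n)) ℂ) : Matrix (Fin (n + n)) (Fin (n + n)) ℂ) * Tinv w)
        (I • (1 : Matrix (Fin n) (Fin n) ℂ)) = I • 1})
    (fun w g => exists_siegel_mul_frameCompact L e dV hdV dW hdW T Tinv hT2 hTU hTV D C hTsh hC w g) (fun k hk => hK k fun w => hk w)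

end Summit.HodgeConjecture.HodgeConjecture.Cruxes.HLiu418.K2LiuArchSectionEqOfFrameCompact

end
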